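import Summits.AtomisticToContinuum.HydrodynamicLimit.Theses.RelayRaceLocality
import Summits.AtomisticToContinuum.HydrodynamicLimit.Theorems.RelayRaceLocalityNearConstantShortTimeHLEntropyToLLN
import Summits.AtomisticToContinuum.HydrodynamicLimit.Theorems.NearConstantShortTimeHL.Negative.LoadBearing
import Summits.AtomisticToContinuum.HydrodynamicLimit.Theorems.NearConstantShortTimeHL.Negative.LawDichotomy
import Literature.Analysis.Complex.BoundedAnalyticFamilyLimit
import HarnessLib.Audit

/-!
# Line `tilt-radius` for the crux `NearConstantShortTimeHL` (stmt-AtomisticToContinuum-12502)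

Route `RelayRaceLocality`, crux #4 (rank 4, "foreign input", open-problem): the NEAR-CONSTANT SHORT-TIME
HYDRODYNAMIC LIMIT for general diameter/number families `(ε_N → 0, n_N ε_N³ → σ³)` — `∃ η₀ ∀ M ∃ δ₀ τ₀ ∀ profiles
∃ σ₀ ∀ σ ∀ families ∀ classical hs-Euler solutions δ₀-near-constant at t = 0 ∀ flows`, canonical local Gibbs laws
probability + LLN at `0` ⟹ LLN at every `t < min T τ₀` under packing/temperature/drift/C¹ guards on `[0,t]`.
planner-cruxplan-stmt-AtomisticToContinuum-12502-tilt-radius-0 (2026-08-16), from the crux idea `Ideas/tilt-radius.md`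
(crux-ideate r1, ideator 1) as repaired by the triage panel (`TRIAGE-r1-1.md`, `TRIAGE-r1-2.md`: pass ×2).

## The lever

The crux's `δ₀(M)` IS A RADIUS OF CONVERGENCE. Write the particle datum as the member `d = d₀` of the TILT RAY
`d ↦ (abar·e^{dα}, ubar + d w, θbar(1 + dϑ))` through a constant state (direction `(α, w, ϑ)` of sup-norm ≤ 1,
Lipschitz constant `L`), and look at the finite-`N` mean `m_N(d)` of a conserved one-body statistic at time `t` under the
canonical local Gibbs law of the member `d` (`rayLaw … d`, a general member `(ε_N, n_N)` of the family):
* STUB 1 `stub_tiltRadius` (HARDEST; "no dynamical Lee–Yang zero"): for `∀ᶠ N`, `m_N` is the restriction of a function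
  holomorphic on the complex disc `|d| < R`, `R(1 + L t) ≤ r₀(M)`, bounded by `C(M)·sup|χ|` UNIFORMLY IN `N`
  (and in the state, the direction, `σ < σ₀(M, L)`, the family, `t ≤ 1`) — the triage-repaired `TiltRadius′`
  (Disproof §4b / TRIAGE: `∀ N ↦ ∀ᶠ N`, shape-uniform radius `r₀ ↦ r₀/(1 + L t)`);
* STUB 2 `stub_jetIdentification` (open-problem, = general-family `TwoTimePressureGerm.EquilibriumResponse` 14332 in
  holomorphic-interpolant form): the Taylor coefficients at `d = 0` of (any holomorphic interpolants of) `m_N` converge,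
  `N → ∞`, to those of the EULER ray map `d ↦ eulerVal(member d at t)` (`k = 0`: invariance of the constant-state law +
  statics; `k = 1`: Spohn's Euler-scale covariance (7.18)–(7.19); `k ≥ 2`: nonlinear Euler response = BMFT);
* STUB 3 `stub_tiedAnalyticRay` (PDE + statics docking; "RayClassicality"): through the crux's given solution (tied to
  the member `d₀`, guarded on `[0,t]`, `t < τE(M)`, `d₀ ≤ dE(M)`) passes a family of classical hs-Euler solutions, one
  for each `d ∈ [0, d₀]`, each TIED at `t = 0` to the law of its member (general-family statics), member `d₀` = the given
  solution, whose tested conserved fields at time `t` extend holomorphically to a disc of radius `> d₀` in `d`;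
* STUB 4 `stub_tieInversion` (statics, general families; delegated flavour): the crux's tie + near-constancy + C¹ guard
  at `t = 0` pin the PARTICLE profile: `u₀ = u(0)`, `θ₀ = θ(0)`, `log a₀` within `K δ` of a constant and `K M`-Lipschitz;
* STUB 5 `stub_meansPin` (the shared DOCK, card `means-pin-entropy`): convergence of the means of the conserved
  statistics at `t` (C⁺ = `MeansConvergeNC`, crux frame) ⟹ the landed Yau-form target `NearConstantRelEntropy`
  (exact entropy identity `Theorems.toReal_klDiv_lawAt_sub` + isentropy + general-family statics), whence the crux by
  the LANDED `stub_entropyToLLN` (p100911).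

## Composition (kernel-checked, sorry-free): `meansConvergeNC_of` and `NearConstantShortTimeHL_of`

`NearConstantShortTimeHL_of h₁ h₂ h₃ h₄ h₅ := stub_entropyToLLN (h₅ (meansConvergeNC_of h₁ h₂ h₃ h₄))` with the real
glue in `meansConvergeNC_of : stub 1 → stub 2 → stub 3 → stub 4 → MeansConvergeNC`: given `M`, put `M₊ = max M 1`,
`M' = 2M₊`; take `(r₀, C)` of stub 1 and `(τE, dE)` of stub 3 at `M'`, `K` of stub 4 at `M₊`;
`d₀ := min (r₀/8) dE`, `δ₀ := d₀/(4 K M₊)`, `L := 2 K M₊²/d₀`, `τ₀ := min (min τE 1) (d₀/(2 K M₊²))` (so `L t ≤ 1`),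
`η₀ := min η₁ ηE`, `σ₀ := min` of the four `σ₀`'s (stub 4's depends on the profile, the others on `M`, `L` only). At the
innermost point: the guards at `s = 0` box the constant state `(θbar, ubar)` by `M'`; stub 4 yields `abar` and the
direction `α := log(a₀/abar)/d₀`, `w := (u₀ − ubar)/d₀`, `ϑ := (θ₀ − θbar)/(θbar d₀)` (sup ≤ 1, `L`-Lipschitz), and
`localGibbsProfile a₀ u₀ θ₀ = localGibbsProfile (aRay …) (uRay …) (θRay …)` at `d₀` (so `P N = rayLaw … d₀`); stub 1 at
`R₁ = 3 d₀` gives interpolants `G N` (extended by `0` before the threshold); stub 3 gives the tied Euler ray, the member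
identity and `F` on `ball 0 RE`, `RE > d₀`; stub 2 gives `iteratedDeriv k (G N) 0 → iteratedDeriv k F 0`; the tree's
`Literature.Analysis.Complex.tendsto_of_forall_tendsto_taylorCoeff` (uniformly bounded analytic family + convergence of
the Taylor coefficients, on `ball 0 (2 d₀)`) and Mathlib's `Complex.taylorSeries_eq_on_ball` give `G N d₀ → F d₀`, i.e.
`E_{P N}[consField ∘ Φ_t] → eulerVal(ρ_t, u_t, θ_t)`; integrability rides with stub 1. No Montel/Vitali subsequence
argument is needed (the tree's Vitali files are the conceptual source).

## Disproof used (`Cruxes/NearConstantShortTimeHL/Disproof.lean`, cdisprove cycle 1; landed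
`Theorems/NearConstantShortTimeHL/Negative/{LoadBearing,LawDichotomy}.lean`, both imported here)
* `nearConstantShortTimeHLUntied_false` (the `t = 0` TIE is load-bearing): honoured — the tie is consumed twice, by
  `stub_tieInversion` (it is what pins the particle profile to the near-constant data) and by `stub_tiedAnalyticRay`
  (member `d₀` of the Euler ray = the given solution BECAUSE it is tied to `rayLaw … d₀ = P`); `θbar, ubar` are used only
  as the centre of the ray, exactly the "no extra information" reading of the negative.
* `nearConstantShortTimeHLNoPDE_false` (the BALANCE LAWS are load-bearing): honoured — `stub_tiedAnalyticRay` and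
  `stub_jetIdentification` quantify over `IsHardSphereEulerSolution` families and identify Euler jets; nothing here
  holds for merely smooth positive fields (the ramp witness `(1 + t, 0, 1)` is not an Euler ray member).
* `LawDichotomy` (`IsProbabilityMeasure (P N) ↔ P N ≠ 0`): used in the junk audit of stub 3 (all ray laws share the
  hard-sphere domain of `P N`, so they are probability measures for every `N` as soon as `P N` is) and of stub 1 (`∀ᶠ N`).
* §4b `TiltRadius` stub-misstated + both triage repairs: ADOPTED verbatim in stub 1 (`∀ᶠ N`; `R (1 + L t) ≤ r₀`).
No stub is an instance of a landed Negative lemma: stubs 3–5 carry the tie and the PDE; stubs 1–2 are statements about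
the tilt ray at the invariant law, not about untied or PDE-free data.

## Negatives index / dead line
`ledger negatives` (HydrodynamicLimit: 9168 adjoint-Enskog junk-EOS family, 9236/9238 degenerate thresholds, 14607,
11470, …): no analyticity / response / statics-identification statement among them. Dead line `Sketch`
(fejer-isometry-window-transfer, `Lines/SketchDead.md`): died at the `a²/γ₀` floor of every transfer from the
flow-INVARIANT law through the entropy inequality; this line moves information from `d = 0` to `d = d₀` by ANALYTIC
CONTINUATION of the means (stub 1 + stub 2), never through `KL(P_t‖G_N)`, and docks on the matched-reference pin (stub 5),
which the panel certified evades the floor.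
-/

noncomputable section

open MeasureTheory Set Metric Filter Topology
open scoped BigOperators Nat
open Literature.Analysis.FluidPDE Literature.MathematicalPhysics.KineticTheory Literature.Analysis.FunctionSpaces
open Summit.AtomisticToContinuum.HydrodynamicLimit.Theses.RelayRaceLocality (NearConstantShortTimeHL)
open Summit.AtomisticToContinuum.HydrodynamicLimit.Theorems.NearConstantShortTimeHL (NearConstantRelEntropy stub_entropyToLLN)

namespace Summit.AtomisticToContinuum.HydrodynamicLimit.Cruxes.NearConstantShortTimeHL.TiltRadius

/-! ## Objects of the line -/

/-- A CONSERVED one-body field statistic of an `n`-particle configuration: the linear combination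
`c₀·(density field) + ⟪c, momentum field⟫ + c₄·(energy field)` of the tree's three empirical fields tested against `χ`
(`χ` times a collision invariant `c₀ + c·v + c₄|v|²/2`, summed over the particles and divided by `n`). -/
def consField {n : ℕ} (c₀ : ℝ) (c : V3) (c₄ : ℝ) (z : Config n (Fin 3) T3) (χ : T3 → ℝ) : ℝ :=
  c₀ * empiricalDensityField z χ + inner ℝ c (empiricalMomentumField z χ) + c₄ * empiricalEnergyField z χ

/-- The Euler value of the conserved statistic `consField c₀ c c₄ · χ` on hydrodynamic fields `(ρ, u, θ)` (time slices):
`c₀ ∫χρ + ⟪c, ∫χρu⟫ + c₄ ∫χE(ρ,u,θ)`. -/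
def eulerVal (c₀ : ℝ) (c : V3) (c₄ : ℝ) (χ : T3 → ℝ) (ρ : T3 → ℝ) (u : T3 → V3) (θ : T3 → ℝ) : ℝ :=
  c₀ * ∫ x, χ x * ρ x + inner ℝ c (∫ x, (χ x * ρ x) • u x) +
    c₄ * ∫ x, χ x * totalEnergyDensity (ρ x) (u x) (θ x)

/-- Activity profile of the TILT RAY of amplitude `d` in direction `α` around the constant activity `abar`:
`x ↦ abar · exp(d α(x))`. -/
def aRay (abar : ℝ) (α : T3 → ℝ) (d : ℝ) : T3 → ℝ := fun x => abar * Real.exp (d * α x)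

/-- Drift profile of the tilt ray: `x ↦ ubar + d w(x)`. -/
def uRay (ubar : V3) (w : T3 → V3) (d : ℝ) : T3 → V3 := fun x => ubar + d • w x

/-- Temperature profile of the tilt ray: `x ↦ θbar (1 + d ϑ(x))`. -/
def θRay (θbar : ℝ) (ϑ : T3 → ℝ) (d : ℝ) : T3 → ℝ := fun x => θbar * (1 + d * ϑ x)

/-- The canonical local Gibbs law of `n` hard spheres of diameter `ε` on `𝕋³` with the profiles of the tilt ray at
amplitude `d` (a general member `(ε, n) = (ε_N, n_N)` of the crux's diameter/number families). -/
def rayLaw (abar θbar : ℝ) (ubar : V3) (α ϑ : T3 → ℝ) (w : T3 → V3) {ε : ℝ} {n : ℕ}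
    (Φ : HardSphereFlow (Torus.geometry (Fin 3)) ε n) (d : ℝ) : Measure (Config n (Fin 3) T3) :=
  particleLaw Φ (canonicalDensity (Torus.geometry (Fin 3)) ε n
    (localGibbsProfile (aRay abar α d) (uRay ubar w d) (θRay θbar ϑ d)))

/-- LAW OF LARGE NUMBERS of the three empirical fields at macroscopic time `t` towards the hydrodynamic fields
`(ρ, u, θ)`, for a GENERAL diameter/number family (the crux's inline tie/conclusion, verbatim, as a predicate;
`TendstoHydroFieldsAt` of the Literature is the special case `n N = N + 1`). -/
def LLNAt {ε : ℕ → ℝ} {n : ℕ → ℕ} (P : (N : ℕ) → Measure (Config (n N) (Fin 3) T3))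
    (Φ : (N : ℕ) → HardSphereFlow (Torus.geometry (Fin 3)) (ε N) (n N))
    (ρ : ℝ → T3 → ℝ) (u : ℝ → T3 → V3) (θ : ℝ → T3 → ℝ) (t : ℝ) : Prop :=
  ∀ χ : T3 → ℝ, Continuous χ → ∀ δ : ℝ, 0 < δ →
    Tendsto (fun N => P N {z | δ < |empiricalDensityField ((Φ N).flow t z) χ - ∫ x, χ x * ρ t x|}) atTop (nhds 0) ∧
    Tendsto (fun N => P N {z | δ < ‖empiricalMomentumField ((Φ N).flow t z) χ - ∫ x, (χ x * ρ t x) • u t x‖})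
      atTop (nhds 0) ∧
    Tendsto (fun N => P N {z | δ < |empiricalEnergyField ((Φ N).flow t z) χ -
      ∫ x, χ x * totalEnergyDensity (ρ t x) (u t x) (θ t x)|}) atTop (nhds 0)

/-- **C⁺ of the dock** (card `means-pin-entropy`, in the crux's own frame): `NearConstantShortTimeHL` with its
conclusion "LLN at `t`" replaced by "the EXPECTATIONS of the conserved one-body statistics at time `t` converge to
their Euler values" (plus eventual integrability, closing the Bochner-junk trap). Prefix = the crux's, verbatim. -/
def MeansConvergeNC : Prop :=
  ∃ η₀ : ℝ, 0 < η₀ ∧ ∀ M : ℝ, 0 < M → ∃ δ₀ : ℝ, 0 < δ₀ ∧ ∃ τ₀ : ℝ, 0 < τ₀ ∧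
    ∀ (a₀ θ₀ : T3 → ℝ) (u₀ : T3 → V3), Continuous a₀ → Continuous θ₀ → Continuous u₀ →
    (∀ x, 0 < a₀ x) → (∀ x, 0 < θ₀ x) → ∃ σ₀ : ℝ, 0 < σ₀ ∧ ∀ σ : ℝ, 0 < σ → σ < σ₀ →
    ∀ (ε : ℕ → ℝ) (n : ℕ → ℕ), (∀ N, 0 < ε N) → Tendsto ε atTop (nhds 0) →
    Tendsto (fun N => (n N : ℝ) * ε N ^ 3) atTop (nhds (σ ^ 3)) →
    ∀ (T : ℝ) (ρ θ : ℝ → T3 → ℝ) (u : ℝ → T3 → V3), IsHardSphereEulerSolution σ T ρ u θ →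
    (∃ (ubar : V3) (θbar : ℝ), ∀ x, |ρ 0 x - 1| ≤ δ₀ ∧ ‖u 0 x - ubar‖ ≤ δ₀ ∧ |θ 0 x - θbar| ≤ δ₀) →
    ∀ Φ : (N : ℕ) → HardSphereFlow (Torus.geometry (Fin 3)) (ε N) (n N),
    let P : (N : ℕ) → Measure (Config (n N) (Fin 3) T3) := fun N =>
      particleLaw (Φ N) (canonicalDensity (Torus.geometry (Fin 3)) (ε N) (n N) (localGibbsProfile a₀ u₀ θ₀));
    (∀ N, IsProbabilityMeasure (P N)) →
    (∀ χ : T3 → ℝ, Continuous χ → ∀ δ : ℝ, 0 < δ →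
      Tendsto (fun N => P N {z | δ < |empiricalDensityField ((Φ N).flow 0 z) χ - ∫ x, χ x * ρ 0 x|}) atTop (nhds 0) ∧
      Tendsto (fun N => P N {z | δ < ‖empiricalMomentumField ((Φ N).flow 0 z) χ - ∫ x, (χ x * ρ 0 x) • u 0 x‖})
        atTop (nhds 0) ∧
      Tendsto (fun N => P N {z | δ < |empiricalEnergyField ((Φ N).flow 0 z) χ -
        ∫ x, χ x * totalEnergyDensity (ρ 0 x) (u 0 x) (θ 0 x)|}) atTop (nhds 0)) →
    ∀ t ∈ Set.Ico 0 (min T τ₀),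
    (∀ s ∈ Set.Icc 0 t, ∀ x, ρ s x * σ ^ 3 < η₀ ∧ θ s x ≤ M ∧ M⁻¹ ≤ θ s x ∧ ‖u s x‖ ≤ M ∧
      ∀ i : Fin 3, |Torus.partialDeriv i (ρ s) x| ≤ M ∧ ‖Torus.partialDeriv i (u s) x‖ ≤ M ∧
        |Torus.partialDeriv i (θ s) x| ≤ M) →
    ∀ χ : T3 → ℝ, Continuous χ → ∀ (c₀ c₄ : ℝ) (c : V3), |c₀| ≤ 1 → |c₄| ≤ 1 → ‖c‖ ≤ 1 →
      (∀ᶠ N : ℕ in atTop, Integrable (fun z => consField c₀ c c₄ ((Φ N).flow t z) χ) (P N)) ∧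
      Tendsto (fun N : ℕ => ∫ z, consField c₀ c c₄ ((Φ N).flow t z) χ ∂(P N)) atTop
        (𝓝 (eulerVal c₀ c c₄ χ (ρ t) (u t) (θ t)))

/-! ## Registered stubs (`Holds.stub_*`, bodies `sorry`) -/

namespace Holds

/-- STUB 1 — `TiltRadius′`: N-UNIFORM BOUNDED HOLOMORPHY OF THE TIME-`t` CONSERVED MEANS IN THE TILT AMPLITUDE
(the HARDEST stub; the line's new content; "no dynamical Lee–Yang zero within radius `r₀/(1+Lt)`").
For every guard size `M ≥ 1` there are `r₀ ∈ (0, 1/2]` and `C ≥ 0`, and for every Lipschitz budget `L ≥ 0` a dilution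
threshold `σ₀(M, L)`, such that: for `σ < σ₀`, every constant state (`abar > 0` free — the canonical law does not see the
scale of the activity —, `θbar ∈ [1/M, M]`, `‖ubar‖ ≤ M`), every continuous direction `(α, ϑ, w)` of sup-norm `≤ 1`
which is `L`-Lipschitz for the sup-metric of `𝕋³ = (ℝ/ℤ)³`, every admissible family `(ε_N, n_N)`, all flows, every
`t ∈ [0, 1]`, every continuous `χ` with `|χ| ≤ B`, all coefficients `|c₀|, |c₄|, ‖c‖ ≤ 1` and every radius `R > 0` with
`R (1 + L t) ≤ r₀`: EVENTUALLY IN `N` the real-`d` mean `m_N(d) = E_{rayLaw d}[consField c₀ c c₄ (Φ_t ·) χ]` is a genuine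
(integrable) expectation for `|d| < R` and is the restriction of a function `g` holomorphic on the complex disc
`|d| < R` with `‖g‖ ≤ C·B` there.
WHY PLAUSIBLE / CONSISTENCY: (i) `t = 0` (or `L = 0`, i.e. constant directions, where the tilted law is again
invariant): pure STATICS — zero-freeness of the canonical partition function in a complex activity/drift/temperature
profile of log-amplitude `< 1/2` at low density (PulvirentiTsagkarogiannis2012 canonical cluster expansion; Ruelle1969
Thm 4.2.3) and boundedness of one-point functions; (ii) FREE FLIGHT: `m_N` is a ratio of entire one-particle integrals,
`N`-free bounds on `|d| < 1/2` (card falsifier 1) — the statement holds there while the crux fails there, so the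
Boltzmann-hypothesis content is NOT in this stub but in stub 2; (iii) holomorphy itself is free: `m_N(d) =
E_G[X_t e^{dΦ₀}]/E_G[e^{dΦ₀}]` is meromorphic with poles only at the STATIC zeros of `Z_N(d) = E_G[e^{dΦ₀}]` — the content
is the `N`-UNIFORM BOUND for `Im d ≠ 0`, i.e. geometric `N`-uniform bounds `|n^k κ^G_{k+1}(Φ₀,…,Φ₀; X_t)| ≤ C k! R^{-k}`
on the mixed space-time cumulants at the invariant law (general-family, all-orders form of
`TwoTimePressureGerm.CumulantBounds`, stmt-9615); (iv) the radius: a sound wave of wavelength `1/k` (`L ≍ k`) and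
amplitude `d` shocks at `t ≍ 1/(C d k)`, and Montel forbids a real-analytic limit across the shock amplitude — hence
`R ≤ r₀/(1 + L t)` (Disproof §4b, TRIAGE r1-1/r1-2), which is all the guarded crux needs (`d₀ + C M t < r₀`);
(v) `∀ᶠ N`: a finite dense member of an admissible family (fcc near contact, TRIAGE r1-1) has poles of `m_N` at
`|d| ≈ 2.405/n`, so `∀ N` is junk-false.
WHY IT MIGHT FAIL: for `Im d ≠ 0`, `|Z_N(d)| ≈ Z_N(Re d) e^{-n Var (Im d)²/2}` and the bound needs the SAME cancellation
in `E_G[X_t e^{dΦ₀}]`: a decay-of-influence statement along collision chains in complex-weighted equilibrium averages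
over backward clusters of cardinality `e^{C N^{1/3} t}` at fixed `σ` — beyond Lanford-type tree expansions; a real
pinch of zeros of the two-time partition function (dynamical phase transition / hidden slow mode) before `τ₀` kills it
(and with it VitaliAmplitudeTransfer's 11870 and 9615 for general families). MD-testable (card falsifier 3: reweighted
equilibrium trajectories, complex grid `|d| ≤ 0.3`, zeros approaching the real axis with `n`).
Size: XL / open-problem. Leans on: `TwoTimePressureGerm.CumulantBounds` (9615), `TiltIdentity` (9620),
`VitaliAmplitudeTransfer.UniformAmplitudeAnalyticity` (11870; conjunct family, path form), Literature
`hsTwoTimePressure` (stationarity / convexity / reversal symmetry PROVED), `InformationPercolationEngine.SpectralContractionR`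
(the one-collision contraction the card bets on); LeeYang1952, Ruelle1969, PulvirentiTsagkarogiannis2012, Spohn1991 §7.1,
BGSSAnnals2023 / BodineauEtAl2024 (cumulant hierarchies), DoyonEtAl2023. -/
theorem stub_tiltRadius :
    ∀ M : ℝ, 1 ≤ M → ∃ r₀ : ℝ, 0 < r₀ ∧ r₀ ≤ 1 / 2 ∧ ∃ C : ℝ, 0 ≤ C ∧ ∀ L : ℝ, 0 ≤ L →
    ∃ σ₀ : ℝ, 0 < σ₀ ∧ ∀ σ : ℝ, 0 < σ → σ < σ₀ →
    ∀ (abar θbar : ℝ) (ubar : V3), 0 < abar → M⁻¹ ≤ θbar → θbar ≤ M → ‖ubar‖ ≤ M →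
    ∀ (α ϑ : T3 → ℝ) (w : T3 → V3), Continuous α → Continuous ϑ → Continuous w →
    (∀ x, |α x| ≤ 1 ∧ |ϑ x| ≤ 1 ∧ ‖w x‖ ≤ 1) →
    (∀ x y, |α x - α y| ≤ L * dist x y ∧ |ϑ x - ϑ y| ≤ L * dist x y ∧ ‖w x - w y‖ ≤ L * dist x y) →
    ∀ (ε : ℕ → ℝ) (n : ℕ → ℕ), (∀ N, 0 < ε N) → Tendsto ε atTop (𝓝 0) →
    Tendsto (fun N => (n N : ℝ) * ε N ^ 3) atTop (𝓝 (σ ^ 3)) →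
    ∀ Φ : (N : ℕ) → HardSphereFlow (Torus.geometry (Fin 3)) (ε N) (n N),
    ∀ t ∈ Set.Icc (0 : ℝ) 1, ∀ χ : T3 → ℝ, Continuous χ → ∀ B : ℝ, (∀ x, |χ x| ≤ B) →
    ∀ (c₀ c₄ : ℝ) (c : V3), |c₀| ≤ 1 → |c₄| ≤ 1 → ‖c‖ ≤ 1 →
    ∀ R : ℝ, 0 < R → R * (1 + L * t) ≤ r₀ →
    ∀ᶠ N : ℕ in atTop, ∃ g : ℂ → ℂ, DifferentiableOn ℂ g (ball 0 R) ∧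
      (∀ ζ ∈ ball (0 : ℂ) R, ‖g ζ‖ ≤ C * B) ∧
      ∀ d : ℝ, |d| < R →
        Integrable (fun z => consField c₀ c c₄ ((Φ N).flow t z) χ) (rayLaw abar θbar ubar α ϑ w (Φ N) d) ∧
        g (d : ℂ) = ((∫ z, consField c₀ c c₄ ((Φ N).flow t z) χ ∂(rayLaw abar θbar ubar α ϑ w (Φ N) d) : ℝ) : ℂ) := by
  sorry

/-- STUB 2 — JET IDENTIFICATION (Spohn's (7.16) interchange at every order = BMFT; the general-family form of
`TwoTimePressureGerm.EquilibriumResponse`, stmt-14332, stated for HOLOMORPHIC INTERPOLANTS so that the whole line stays in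
`ℂ`). Frame: a constant state boxed by `M`, a continuous direction of sup-norm `≤ 1`, `σ < σ₀(M)`, an admissible family,
flows; a family `(ρE d, uE d, θE d)`, `d ∈ [0, d₁]`, of classical hs-Euler solutions on `[0, T')` each of which is the
matched solution of its ray member (the member law `rayLaw … d` is a probability measure for every `N` and satisfies the
LLN at `t = 0` towards the member's fields — the TIE along the ray); a time `t < T'`, a continuous `χ`, coefficients.
CLAIM: if `G N` are (eventually) holomorphic on a disc `|d| < r` and interpolate the finite-`N` means `m_N(d)` at real
`|d| < r`, and `F` is holomorphic on a disc `|d| < r'` and interpolates the Euler ray map `d ↦ eulerVal(member d at t)`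
on `[0, min(d₁, r'))`, then for every order `k`, `G_N^{(k)}(0) → F^{(k)}(0)` as `N → ∞`.
(All interpolants of either side have the same jets; if no interpolant exists the statement is vacuous, and stubs 1 / 3
supply them.) CONTENT BY ORDER: `k = 0` — the member `0` law is the constant-state canonical law, INVARIANT under every
hard-sphere flow, with uniform one-point density by translation invariance and Maxwellian velocity moments, while member
`0` of the Euler ray has constant data hence is the constant solution (classical uniqueness in the dilute band): both sides
equal `c₀∫χ + ⟪c, ubar⟫∫χ + c₄(‖ubar‖²/2 + 3θbar/2)∫χ` — provable statics; `k = 1` — `n·Cov_G(Φ₀, X_t) →` the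
LINEARISED hs-Euler response at time `t` = Spohn's Euler-scale covariance conjecture (7.18)–(7.19) =
`CramerEdgeLadder.EulerScaleCovariance` (9616) / `MourreKoopmanCharges.OneBodyCompleteness` (9583) in ray form, OPEN at
every fixed `σ > 0`; `k ≥ 2` — `n^k`-scaled mixed cumulants `κ_G(Φ₀^k; X_t) →` the `(k−1)`-st NONLINEAR Euler response
(ballistic MFT, DoyonEtAl2023 §3.1, DoyonMyers2019), constrained for free by the proved reversal symmetry
`hsTwoTimePressure_reverse`.
WHY IT MIGHT FAIL: a sixth slow one-body mode / excess Drude weight at fixed `σ` falsifies `k = 1` (and the crux with it: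
BoltzmannHypothesisBarrier in its narrow form); orders `≥ 2` could converge to a non-BMFT value (an `O(σ³)` Enskog-level
mismatch of the mean currents) — then the line still gives the crux iff the limits are the jets of SOME analytic function
equal to the Euler map, which is exactly what would fail. The statement is false for the ideal gas (free transport ≠ Euler)
as it must be (stub 1 holds there).
Size: open-problem (k = 1 alone is). Leans on: `TwoTimePressureGerm.EquilibriumResponse` (14332) / `TiltIdentity`
(9620) / `CumulantBounds` (9615); `measurePreserving_flow_localGibbsLaw_const` (invariance, tree);
`PolynomialCompressionConstantProfiles.unique_of_dilute` (tree); Spohn1991 §7.1 (7.16)–(7.19), DoyonEtAl2023,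
DoyonMyers2019, PerfettoDoyon2021, TothValko2003, VanbeijerenEtAl1980, BGSSCPAM2023. -/
theorem stub_jetIdentification :
    ∀ M : ℝ, 1 ≤ M → ∃ σ₀ : ℝ, 0 < σ₀ ∧ ∀ σ : ℝ, 0 < σ → σ < σ₀ →
    ∀ (abar θbar : ℝ) (ubar : V3), 0 < abar → M⁻¹ ≤ θbar → θbar ≤ M → ‖ubar‖ ≤ M →
    ∀ (α ϑ : T3 → ℝ) (w : T3 → V3), Continuous α → Continuous ϑ → Continuous w →
    (∀ x, |α x| ≤ 1 ∧ |ϑ x| ≤ 1 ∧ ‖w x‖ ≤ 1) →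
    ∀ (ε : ℕ → ℝ) (n : ℕ → ℕ), (∀ N, 0 < ε N) → Tendsto ε atTop (𝓝 0) →
    Tendsto (fun N => (n N : ℝ) * ε N ^ 3) atTop (𝓝 (σ ^ 3)) →
    ∀ Φ : (N : ℕ) → HardSphereFlow (Torus.geometry (Fin 3)) (ε N) (n N),
    ∀ (d₁ T' : ℝ), 0 < d₁ → 0 < T' →
    ∀ (ρE θE : ℝ → ℝ → T3 → ℝ) (uE : ℝ → ℝ → T3 → V3),
    (∀ d ∈ Set.Icc 0 d₁, IsHardSphereEulerSolution σ T' (ρE d) (uE d) (θE d)) →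
    (∀ d ∈ Set.Icc 0 d₁, (∀ N, IsProbabilityMeasure (rayLaw abar θbar ubar α ϑ w (Φ N) d)) ∧
      LLNAt (fun N => rayLaw abar θbar ubar α ϑ w (Φ N) d) Φ (ρE d) (uE d) (θE d) 0) →
    ∀ t ∈ Set.Ico 0 T', ∀ χ : T3 → ℝ, Continuous χ → ∀ (c₀ c₄ : ℝ) (c : V3),
    ∀ (G : ℕ → ℂ → ℂ) (r : ℝ), 0 < r →
    (∀ᶠ N : ℕ in atTop, DifferentiableOn ℂ (G N) (ball 0 r) ∧ ∀ d : ℝ, |d| < r →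
      G N (d : ℂ) = ((∫ z, consField c₀ c c₄ ((Φ N).flow t z) χ ∂(rayLaw abar θbar ubar α ϑ w (Φ N) d) : ℝ) : ℂ)) →
    ∀ (F : ℂ → ℂ) (r' : ℝ), 0 < r' → DifferentiableOn ℂ F (ball 0 r') →
    (∀ d : ℝ, 0 ≤ d → d ≤ d₁ → d < r' → F (d : ℂ) = ((eulerVal c₀ c c₄ χ (ρE d t) (uE d t) (θE d t) : ℝ) : ℂ)) →
    ∀ k : ℕ, Tendsto (fun N : ℕ => iteratedDeriv k (G N) 0) atTop (𝓝 (iteratedDeriv k F 0)) := by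
  sorry

/-- STUB 3 — THE TIED ANALYTIC EULER RAY (RayClassicality + amplitude analyticity of the Euler side + the ties of
the ray members; PDE with a statics docking). There is a packing allowance `ηE` and, for every `M ≥ 1`, a horizon
`τE(M) > 0`, an amplitude allowance `dE(M) > 0` and `σ₀(M)` such that: for a boxed constant state, a continuous direction
of sup-norm `≤ 1`, an amplitude `0 < d₀ ≤ dE`, `σ < σ₀`, an admissible family, a classical hs-Euler solution
`(ρ, u, θ)` on `[0, T)` and flows, IF the member-`d₀` laws `rayLaw … d₀` are probability measures and TIE the solution at
`t = 0` (LLN), then for every `t < min T τE` at which the solution obeys the crux's guards (packing `< ηE`,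
`θ ∈ [1/M, M]`, `‖u‖ ≤ M`, first `Torus.partialDeriv`s `≤ M` on `[0, t]`) there are `T' > t` and a family
`(ρE d, uE d, θE d)`, `d ∈ [0, d₀]`, with: (i) each member a classical hs-Euler solution on `[0, T')`; (ii) member `d₀`
= `(ρ, u, θ)` on `[0, T')`; (iii) every member law `rayLaw … d` a probability measure for every `N` and TIED at `t = 0`
to its member; (iv) for every continuous `χ` and coefficients, the Euler ray map `d ↦ eulerVal(member d at t)` on
`[0, d₀]` is the restriction of a function holomorphic on a complex disc `|d| < RE` with `RE > d₀`.
PROOF PLAN / WHY PLAUSIBLE: (iii, prob) all ray laws share the hard-sphere domain of `rayLaw … d₀`, whose partition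
function is positive and finite iff the law is a probability measure (landed `LawDichotomy`), and positive profiles with
temperature `θbar(1 + dϑ) ≥ θbar/2` keep it so — TRUE for every `N`; (iii, tie) + data: general-family STATICS (the
low-density LLN with the local equation of state `R_σ`, `VitaliAmplitudeTransfer.LocalGibbsStatics` 11874 re-run
σ-locally-uniformly, cf. `UniformLocalGibbsConcentration` 14445 PROVED for the conjunct family) give the data
`(R_σ(e^{μ_d} abar e^{dα}), ubar + d w, θbar(1 + dϑ))` of member `d`; the tie at `d₀` and uniqueness of limits in
probability (`DenseExcursionAtTimeZero.eq_of_tendsto_measure_lt_abs`) identify them with `(ρ, u, θ)(0)` at `d = d₀`, so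
the direction is a posteriori smooth and all members have smooth near-constant data with gradients `≤ (d/d₀)·C M`;
(i)+(ii): member `d₀ :=` the given solution restricted to `[0, T')` (restriction of `IsHardSphereEulerSolution` to a
shorter interval; classical uniqueness in the dilute analytic-EOS band, `unique_of_dilute` pattern); members `d < d₀`:
RAY CLASSICALITY — smaller-amplitude siblings of a guarded pre-shock datum stay classical on `[0, t]` for
`t < τE(M) ≍ 1/(C M)` (1-D: shock time `−1/min ∂_x(Riemann invariant)` is monotone in the amplitude; multi-D: H^s energy
estimates + continuation criterion `∫‖∇U‖_∞ < ∞`, Majda1984 Thm 2.2, Kato1975); (iv): analytic dependence on the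
amplitude — the amplitude expansion `U(d) = Ū + Σ_k d^k U_k(t)` (iterated LINEARISED hs-Euler with polynomial sources,
symmetric-hyperbolic in the analytic low-density EOS band `HsEosLowDensity`, PROVED) converges in `C¹` for
`|d| < RE(t) ≍ c/(L t)`, which exceeds `d₀` exactly in the guarded regime `d₀ L t ≲ M t < c` (majorant method in
`H^{s−1}`, AlinhacMetivier1984-type propagation; `VitaliAmplitudeTransfer.AnalyticPreShockPaths` 11873 is the path form).
WHY IT MIGHT FAIL (the honest PDE flank of the line, TRIAGE r1-1/r1-2): the crux guards only `C¹` norms, while lifespan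
lower bounds and the convergence radius of the amplitude expansion in 3-D are `H³`-type statements — a `C¹`-guarded
classical member `d₀` whose half-amplitude sibling focuses and shocks before `t`, or whose amplitude series has radius
`≤ d₀` at time `t < τE(M)`, refutes (iv)/(i); the fallback (τE depending on an `H³` bound of the data, enough for
`ConeLocalisation`'s flattened profiles with `‖·‖_{H³} ≍ M/r²`) is WEAKER than the crux as typed and would not close it.
Size: L (statics re-run) + L/XL (PDE). Leans on: `IsHardSphereEulerSolution`, `HsEosLowDensity` (0768, PROVED),
`VitaliAmplitudeTransfer.{AnalyticPreShockPaths, LocalGibbsStatics}` (11873/11874), `UniformLocalGibbsConcentration`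
(14445), `eq_of_tendsto_measure_lt_abs`, `rhoLim`/`lln_rhoLim` (tree statics, conjunct family); Kato1975, Majda1984,
Sideris1985 (the direction that does not help), AlinhacMetivier1984, Christodoulou2008, PulvirentiTsagkarogiannis2012. -/
theorem stub_tiedAnalyticRay :
    ∃ ηE : ℝ, 0 < ηE ∧ ∀ M : ℝ, 1 ≤ M → ∃ τE : ℝ, 0 < τE ∧ ∃ dE : ℝ, 0 < dE ∧
    ∃ σ₀ : ℝ, 0 < σ₀ ∧ ∀ σ : ℝ, 0 < σ → σ < σ₀ →
    ∀ (abar θbar : ℝ) (ubar : V3), 0 < abar → M⁻¹ ≤ θbar → θbar ≤ M → ‖ubar‖ ≤ M →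
    ∀ (α ϑ : T3 → ℝ) (w : T3 → V3), Continuous α → Continuous ϑ → Continuous w →
    (∀ x, |α x| ≤ 1 ∧ |ϑ x| ≤ 1 ∧ ‖w x‖ ≤ 1) →
    ∀ d₀ : ℝ, 0 < d₀ → d₀ ≤ dE →
    ∀ (ε : ℕ → ℝ) (n : ℕ → ℕ), (∀ N, 0 < ε N) → Tendsto ε atTop (𝓝 0) →
    Tendsto (fun N => (n N : ℝ) * ε N ^ 3) atTop (𝓝 (σ ^ 3)) →
    ∀ (T : ℝ) (ρ θ : ℝ → T3 → ℝ) (u : ℝ → T3 → V3), IsHardSphereEulerSolution σ T ρ u θ →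
    ∀ Φ : (N : ℕ) → HardSphereFlow (Torus.geometry (Fin 3)) (ε N) (n N),
    (∀ N, IsProbabilityMeasure (rayLaw abar θbar ubar α ϑ w (Φ N) d₀)) →
    LLNAt (fun N => rayLaw abar θbar ubar α ϑ w (Φ N) d₀) Φ ρ u θ 0 →
    ∀ t ∈ Set.Ico 0 (min T τE),
    (∀ s ∈ Set.Icc 0 t, ∀ x, ρ s x * σ ^ 3 < ηE ∧ θ s x ≤ M ∧ M⁻¹ ≤ θ s x ∧ ‖u s x‖ ≤ M ∧
      ∀ i : Fin 3, |Torus.partialDeriv i (ρ s) x| ≤ M ∧ ‖Torus.partialDeriv i (u s) x‖ ≤ M ∧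
        |Torus.partialDeriv i (θ s) x| ≤ M) →
    ∃ T' : ℝ, t < T' ∧ ∃ (ρE θE : ℝ → ℝ → T3 → ℝ) (uE : ℝ → ℝ → T3 → V3),
      (∀ d ∈ Set.Icc 0 d₀, IsHardSphereEulerSolution σ T' (ρE d) (uE d) (θE d)) ∧
      (∀ s ∈ Set.Ico 0 T', ρE d₀ s = ρ s ∧ uE d₀ s = u s ∧ θE d₀ s = θ s) ∧
      (∀ d ∈ Set.Icc 0 d₀, (∀ N, IsProbabilityMeasure (rayLaw abar θbar ubar α ϑ w (Φ N) d)) ∧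
        LLNAt (fun N => rayLaw abar θbar ubar α ϑ w (Φ N) d) Φ (ρE d) (uE d) (θE d) 0) ∧
      ∀ χ : T3 → ℝ, Continuous χ → ∀ (c₀ c₄ : ℝ) (c : V3),
        ∃ RE : ℝ, d₀ < RE ∧ ∃ F : ℂ → ℂ, DifferentiableOn ℂ F (ball 0 RE) ∧
          ∀ d ∈ Set.Icc 0 d₀, F (d : ℂ) = ((eulerVal c₀ c c₄ χ (ρE d t) (uE d t) (θE d t) : ℝ) : ℂ) := by
  sorry

/-- STUB 4 — TIE INVERSION (general-family STATICS; delegated flavour, shared need of every line on this crux).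
There is a packing allowance `η₁` and, for every `M ≥ 1`, a constant `K ≥ 1` such that for all continuous positive
profiles `(a₀, θ₀, u₀)` there is `σ₀` (depending on the profile, as in the crux) with: for `σ < σ₀`, every admissible
family, every classical hs-Euler solution on `[0, T)`, `T > 0`, whose `t = 0` fields are `δ`-near the constants
`(1, ubar, θbar)` (`δ ≤ 1/(2M)`) and obey the guards at `t = 0` (packing `< η₁`, `θ(0) ∈ [1/M, M]`, `‖u(0)‖ ≤ M`, first
`Torus.partialDeriv`s `≤ M`), and all flows: IF the canonical local Gibbs laws `P N` of `(a₀, u₀, θ₀)` are probability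
measures and TIE the solution at `t = 0` (LLN), THEN `u₀ = u(0)`, `θ₀ = θ(0)`, and for some `abar > 0`,
`|log (a₀ x / abar)| ≤ K δ` for all `x` and `log a₀`, `u₀`, `θ₀` are `K M`-Lipschitz for the sup-metric of `𝕋³`.
PROOF PLAN: (1) general-family low-density statics: under `P N` the three empirical fields at `t = 0` satisfy the LLN
towards `(R_σ(e^{μ} a₀(x)), u₀, θ₀)` with the LOCAL equation of state `R_σ` (density vs activity of the homogeneous
gas at reduced diameter `σ`, real-analytic, strictly increasing, `R_σ(z) = z(1 + O(zσ³))`) and `μ` the canonical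
normalisation `∫ R_σ(e^μ a₀) = 1` — `VitaliAmplitudeTransfer.LocalGibbsStatics` (11874) for families
`(ε_N, n_N)` with `n_N ε_N³ → σ³` (σ-local uniformity of the cluster expansion; `UniformLocalGibbsConcentration` 14445 and
`lln_rhoLim` are the conjunct-family theorems); (2) uniqueness of limits in probability under probability measures
(`eq_of_tendsto_measure_lt_abs`) gives `∫χρ(0) = ∫χ R_σ(e^μ a₀)`, `∫χρ(0)u(0) = ∫χ R_σ(e^μ a₀) u₀`, `∫χE(0) = …` for all
continuous `χ`, hence (continuous functions with equal integrals against all continuous `χ` coincide, `ρ > 0`)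
`ρ(0) = R_σ(e^μ a₀)`, `u₀ = u(0)`, `θ₀ = θ(0)`; (3) `log a₀ = log R_σ⁻¹(ρ(0,·)) − μ` with `ρ(0) ∈ [1−δ, 1+δ] ⊆ [1/2, 3/2]`,
`log ∘ R_σ⁻¹` `K'`-Lipschitz there: take `abar := e^{−μ} R_σ⁻¹(1)`; (4) Lipschitz bounds: mean value inequality on the
torus from the `partialDeriv` guards of the smooth slices `ρ(0), u(0), θ(0)` (genuine derivatives: `T > 0`,
`IsSmoothSpaceTimeOn`), Euclidean vs sup metric costs `√3`, composed with `log ∘ R_σ⁻¹`.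
WHY PLAUSIBLE: each step is provable-grade; the only non-routine input is the σ-locally-uniform re-run of the canonical
cluster expansion for general families (≈ the conjunct-family statics with one more parameter, lead notes of line Sketch
§2e/§4B). Not refutable: for wild `a₀` no near-constant tie exists (vacuous), and `σ₀` is allowed to depend on the profile.
Size: L. Leans on: `LocalGibbsStatics` (11874), `UniformLocalGibbsConcentration` (14445, PROVED), `HsEosLowDensity`
(0768, PROVED), `lln_rhoLim` / `rhoLim` / `admissible_iff_data` (tree), `eq_of_tendsto_measure_lt_abs` (tree),
`AntiMazurCoboundariesKineticWindowGronwallActivityInversion` (activity inversion by IFT, tree); Ruelle1969 Thm 4.2.3,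
LebowitzPenrose1964, PulvirentiTsagkarogiannis2012, Georgii1994. -/
theorem stub_tieInversion :
    ∃ η₁ : ℝ, 0 < η₁ ∧ ∀ M : ℝ, 1 ≤ M → ∃ K : ℝ, 1 ≤ K ∧
    ∀ (a₀ θ₀ : T3 → ℝ) (u₀ : T3 → V3), Continuous a₀ → Continuous θ₀ → Continuous u₀ →
    (∀ x, 0 < a₀ x) → (∀ x, 0 < θ₀ x) → ∃ σ₀ : ℝ, 0 < σ₀ ∧ ∀ σ : ℝ, 0 < σ → σ < σ₀ →
    ∀ (ε : ℕ → ℝ) (n : ℕ → ℕ), (∀ N, 0 < ε N) → Tendsto ε atTop (𝓝 0) →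
    Tendsto (fun N => (n N : ℝ) * ε N ^ 3) atTop (𝓝 (σ ^ 3)) →
    ∀ (T : ℝ) (ρ θ : ℝ → T3 → ℝ) (u : ℝ → T3 → V3), IsHardSphereEulerSolution σ T ρ u θ → 0 < T →
    ∀ δ : ℝ, 0 < δ → δ ≤ (2 * M)⁻¹ → ∀ (ubar : V3) (θbar : ℝ),
    (∀ x, |ρ 0 x - 1| ≤ δ ∧ ‖u 0 x - ubar‖ ≤ δ ∧ |θ 0 x - θbar| ≤ δ) →
    (∀ x, ρ 0 x * σ ^ 3 < η₁ ∧ θ 0 x ≤ M ∧ M⁻¹ ≤ θ 0 x ∧ ‖u 0 x‖ ≤ M ∧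
      ∀ i : Fin 3, |Torus.partialDeriv i (ρ 0) x| ≤ M ∧ ‖Torus.partialDeriv i (u 0) x‖ ≤ M ∧
        |Torus.partialDeriv i (θ 0) x| ≤ M) →
    ∀ Φ : (N : ℕ) → HardSphereFlow (Torus.geometry (Fin 3)) (ε N) (n N),
    (∀ N, IsProbabilityMeasure (particleLaw (Φ N)
      (canonicalDensity (Torus.geometry (Fin 3)) (ε N) (n N) (localGibbsProfile a₀ u₀ θ₀)))) →
    LLNAt (fun N => particleLaw (Φ N)
      (canonicalDensity (Torus.geometry (Fin 3)) (ε N) (n N) (localGibbsProfile a₀ u₀ θ₀))) Φ ρ u θ 0 →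
    u₀ = u 0 ∧ θ₀ = θ 0 ∧ ∃ abar : ℝ, 0 < abar ∧ (∀ x, |Real.log (a₀ x / abar)| ≤ K * δ) ∧
      ∀ x y, |Real.log (a₀ x) - Real.log (a₀ y)| ≤ K * M * dist x y ∧
        ‖u₀ x - u₀ y‖ ≤ K * M * dist x y ∧ |θ₀ x - θ₀ y| ≤ K * M * dist x y := by
  sorry

/-- STUB 5 — THE MEANS PIN (the shared DOCK of the surviving crux ideas; card `means-pin-entropy`, TRIAGE: "true in
substance and the right transfer"). `MeansConvergeNC` (the crux with its conclusion replaced by: for every continuous `χ`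
and coefficients bounded by `1`, the means `E_{P N}[consField c₀ c c₄ (Φ_t ·) χ]` are eventually genuine and converge to
`eulerVal c₀ c c₄ χ (ρ_t, u_t, θ_t)`) IMPLIES the landed Yau-form target `NearConstantRelEntropy` (same prefix; reference
laws `Q_N` exponentially concentrating around the Euler fields at `t` with `KL((Φ_N t)_* P_N ‖ Q_N)/n_N → 0`), whence the
crux by the LANDED `stub_entropyToLLN` (p100911). PROOF PLAN: `Q_N := ψ^E_t`, the canonical local Gibbs law (same
`(ε_N, n_N)`) of the profile matched to the Euler fields at `t` (activity `R_σ⁻¹`-inverted from `ρ_t`, drift `u_t`,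
temperature `θ_t`); the EXACT finite-`N` identity `KL((Φ_t)_*ψ₀ ‖ ψ_t) = E₀[log dψ₀] − E_t[log dψ_t]`
(`Theorems.toReal_klDiv_lawAt_sub`, general `(ε, n)`, LANDED) with `log dψ = n·(1/n)Σ_i Λ(z_i) − log Z_N(Λ)` and
`Λ(x,v) = λ⁰(x) + λ(x)·v + λ⁴(x)|v|²/2` (`MacroClosureLine.log_localGibbsProfile_eq_quad`) makes `E_t[log dψ_t]/n` a sum of
FIVE means of `consField`-statistics (test functions `λ⁰_t, λ_{t,j}, λ⁴_t`, coefficients `(1,0,0), (0,e_j,0), (0,0,1)`) —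
supplied by the hypothesis — plus the pressures `log Z_N/n → P(λ)` (general-family statics, σ-locally uniform); the limit of
`KL/n` is then `[⟨λ₀, U^E_0⟩ − P(λ₀)] − [⟨λ^E_t, U^E_t⟩ − P(λ^E_t)] = s(U^E_0) − s(U^E_t) = 0` by ISENTROPY of classical
hs-Euler solutions (`𝔰 = 3/2 log θ − log ρ − f_ex(ρσ³)`, Gibbs relation checked against `hsPressure = ρθ(1 + η f_ex'(η))`
in the `HsEosLowDensity` band — the packing guard is load-bearing here; TRIAGE r1-1/r1-2 re-derived it); exponential
concentration of `ψ^E_t` around the Euler fields is static large deviations for slowly varying tilts (general-family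
re-run of `UniformLocalGibbsConcentration` 14445); the witnesses `(η₀, δ₀, τ₀, σ₀)` of the target are those of the
hypothesis shrunk by the static thresholds.
WHY IT MIGHT FAIL: only through the general-family statics (σ-local uniformity of pressure and concentration for
`x`-dependent tilts) or a thermodynamic inconsistency of the tree's EOS triple (excluded by the triage computation); no
dynamics enters. Size: M–L. Leans on: `Theorems.toReal_klDiv_lawAt_sub`, `log_localGibbsProfile_eq_quad`,
`NearConstantRelEntropy` / `stub_entropyToLLN` (LANDED), `HsEosLowDensity` (PROVED), `UniformLocalGibbsConcentration`
(14445), `TwoTimePressureGerm.MeanEulerLimit` (14333, the conjunct-frame cousin of the hypothesis); Yau1991 §2,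
OllaVaradhanYau1993 §3, Jaynes1965, Csiszar1975, Spohn1991 Part I §3. -/
theorem stub_meansPin : MeansConvergeNC → NearConstantRelEntropy := by
  sorry

end Holds

/-! ## Stub statements by name (D-0027 §3.3) -/

/-- Statement of stub 1, by name. -/
def stub_tiltRadius : Prop := type_of% Holds.stub_tiltRadius
/-- Statement of stub 2, by name. -/
def stub_jetIdentification : Prop := type_of% Holds.stub_jetIdentification
/-- Statement of stub 3, by name. -/
def stub_tiedAnalyticRay : Prop := type_of% Holds.stub_tiedAnalyticRay
/-- Statement of stub 4, by name. -/
def stub_tieInversion : Prop := type_of% Holds.stub_tieInversion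
/-- Statement of stub 5, by name. -/
def stub_meansPin : Prop := type_of% Holds.stub_meansPin

/-! ## Composition -/

/-- ENGINE ⇒ C⁺: the four engine/docking stubs give convergence of the means in the crux's frame. -/
theorem meansConvergeNC_of (h₁ : stub_tiltRadius) (h₂ : stub_jetIdentification) (h₃ : stub_tiedAnalyticRay)
    (h₄ : stub_tieInversion) : MeansConvergeNC := by
  classical
  have H1 := (h₁ : type_of% Holds.stub_tiltRadius)
  have H2 := (h₂ : type_of% Holds.stub_jetIdentification)
  have H3 := (h₃ : type_of% Holds.stub_tiedAnalyticRay)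
  have H4 := (h₄ : type_of% Holds.stub_tieInversion)
  obtain ⟨ηE, hηE, H3⟩ := H3
  obtain ⟨η₁, hη₁, H4⟩ := H4
  refine ⟨min η₁ ηE, lt_min hη₁ hηE, fun M hM => ?_⟩
  -- normalised guard sizes `Mp = max M 1 ≥ 1` and `M' = 2 Mp` (box of the constant reference state)
  set Mp : ℝ := max M 1 with hMp
  have hMp1 : 1 ≤ Mp := le_max_right _ _
  have hMMp : M ≤ Mp := le_max_left _ _
  have hMp0 : 0 < Mp := one_pos.trans_le hMp1
  set M' : ℝ := 2 * Mp with hM'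
  have hM'1 : 1 ≤ M' := by linarith
  have hM'0 : 0 < M' := by linarith
  have hMM' : M ≤ M' := by linarith
  have hinvMp : Mp⁻¹ ≤ M⁻¹ := inv_anti₀ hM hMMp
  have hinvM' : M'⁻¹ ≤ M⁻¹ := inv_anti₀ hM hMM'
  -- constants of the stubs
  obtain ⟨r₀, hr₀, hr₀h, C, hC, H1⟩ := H1 M' hM'1
  obtain ⟨σ₂, hσ₂, H2⟩ := H2 M' hM'1
  obtain ⟨τE, hτE, dE, hdE, σ₃, hσ₃, H3⟩ := H3 M' hM'1
  obtain ⟨K, hK, H4⟩ := H4 Mp hMp1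
  have hK0 : 0 < K := one_pos.trans_le hK
  -- the amplitude `d₀`, the near-constancy allowance `δ₀`, the Lipschitz budget `L`, the time horizon `τ₀`
  set d₀ : ℝ := min (r₀ / 8) dE with hd₀
  have hd₀0 : 0 < d₀ := lt_min (by positivity) hdE
  have hd₀r : d₀ ≤ r₀ / 8 := min_le_left _ _
  have hd₀E : d₀ ≤ dE := min_le_right _ _
  have hd₀1 : d₀ ≤ 1 := by linarith
  set δ₀ : ℝ := d₀ / (4 * K * Mp) with hδ₀
  have hδ₀0 : 0 < δ₀ := by positivity
  have hKδ : K * δ₀ = d₀ / (4 * Mp) := by rw [hδ₀]; field_simp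
  have hKMp1 : (1 : ℝ) ≤ K * Mp := by
    have := mul_le_mul hK hMp1 zero_le_one hK0.le
    simpa using this
  have hδd : δ₀ ≤ d₀ := by
    rw [hδ₀]
    refine div_le_self hd₀0.le ?_
    calc (1 : ℝ) ≤ K * Mp := hKMp1
      _ ≤ 4 * (K * Mp) := by linarith [hKMp1]
      _ = 4 * K * Mp := by ring
  have hδhalf : δ₀ ≤ (2 * Mp)⁻¹ := by
    rw [hδ₀, div_le_iff₀ (by positivity)]
    have : (2 * Mp)⁻¹ * (4 * K * Mp) = 2 * K := by field_simp; ring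
    rw [this]; linarith
  have hδ1 : δ₀ ≤ 1 := hδhalf.trans (inv_le_one_of_one_le₀ (by linarith))
  set L : ℝ := 2 * K * Mp ^ 2 / d₀ with hL
  have hL0 : 0 ≤ L := by positivity
  have hKML : K * Mp / d₀ ≤ L := by
    rw [hL]
    apply div_le_div_of_nonneg_right _ hd₀0.le
    calc K * Mp = K * Mp * 1 := (mul_one _).symm
      _ ≤ K * Mp * (2 * Mp) := mul_le_mul_of_nonneg_left (by linarith) (by positivity)
      _ = 2 * K * Mp ^ 2 := by ring
  obtain ⟨σ₁, hσ₁, H1⟩ := H1 L hL0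
  set τ₀ : ℝ := min (min τE 1) (d₀ / (2 * K * Mp ^ 2)) with hτ₀
  have hτ₀0 : 0 < τ₀ := lt_min (lt_min hτE one_pos) (by positivity)
  refine ⟨δ₀, hδ₀0, τ₀, hτ₀0, fun a₀ θ₀ u₀ ha hθ hu ha0 hθ0 => ?_⟩
  obtain ⟨σ₄, hσ₄, H4⟩ := H4 a₀ θ₀ u₀ ha hθ hu ha0 hθ0
  refine ⟨min σ₄ (min σ₁ (min σ₂ σ₃)), lt_min hσ₄ (lt_min hσ₁ (lt_min hσ₂ hσ₃)), ?_⟩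
  intro σ hσ hσlt ε n hε hε0 hn T ρ θ u hsol hnc Φ P hP h0 t ht hg χ hχ c₀ c₄ c hc₀ hc₄ hc
  have hσ4 : σ < σ₄ := hσlt.trans_le (min_le_left _ _)
  have hσ1 : σ < σ₁ := hσlt.trans_le ((min_le_right _ _).trans (min_le_left _ _))
  have hσ2 : σ < σ₂ :=
    hσlt.trans_le ((min_le_right _ _).trans ((min_le_right _ _).trans (min_le_left _ _)))
  have hσ3 : σ < σ₃ :=
    hσlt.trans_le ((min_le_right _ _).trans ((min_le_right _ _).trans (min_le_right _ _)))
  -- the time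
  have ht0 : 0 ≤ t := ht.1
  have htT : t < T := ht.2.trans_le (min_le_left _ _)
  have htτ : t < τ₀ := ht.2.trans_le (min_le_right _ _)
  have hT : 0 < T := ht0.trans_lt htT
  have htE : t < τE := htτ.trans_le ((min_le_left _ _).trans (min_le_left _ _))
  have ht1 : t ≤ 1 := (htτ.trans_le ((min_le_left _ _).trans (min_le_right _ _))).le
  have htL : t ≤ d₀ / (2 * K * Mp ^ 2) := (htτ.trans_le (min_le_right _ _)).le
  have hLt : L * t ≤ 1 := by
    calc L * t ≤ L * (d₀ / (2 * K * Mp ^ 2)) := by gcongr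
      _ = 1 := by rw [hL]; field_simp
  -- guards at time `0`, the constant reference state and its box
  have hg0 := hg 0 ⟨le_rfl, ht0⟩
  obtain ⟨ubar, θbar, hnc⟩ := hnc
  set x₀ : T3 := 0
  have hθx := abs_sub_le_iff.1 (hnc x₀).2.2
  have hθlo : Mp⁻¹ ≤ θ 0 x₀ := hinvMp.trans (hg0 x₀).2.2.1
  have hM'inv : M'⁻¹ = Mp⁻¹ - (2 * Mp)⁻¹ := by rw [hM']; field_simp; ring
  have hθbar_lo : M'⁻¹ ≤ θbar := by rw [hM'inv]; linarith [hθx.1]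
  have hθbar_hi : θbar ≤ M' := by linarith [(hg0 x₀).2.1, hθx.2]
  have hθbar0 : 0 < θbar := (inv_pos.2 hM'0).trans_le hθbar_lo
  have hθbar_inv : θbar⁻¹ ≤ M' := by
    have := inv_anti₀ (inv_pos.2 hM'0) hθbar_lo
    rwa [inv_inv] at this
  have hubar : ‖ubar‖ ≤ M' := by
    calc ‖ubar‖ = ‖u 0 x₀ - (u 0 x₀ - ubar)‖ := by rw [sub_sub_cancel]
      _ ≤ ‖u 0 x₀‖ + ‖u 0 x₀ - ubar‖ := norm_sub_le _ _
      _ ≤ M + δ₀ := add_le_add (hg0 x₀).2.2.2.1 (hnc x₀).2.1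
      _ ≤ M' := by linarith
  -- STUB 4: tie inversion — the particle profile in the tilt frame
  have hguard0 : ∀ x, ρ 0 x * σ ^ 3 < η₁ ∧ θ 0 x ≤ Mp ∧ Mp⁻¹ ≤ θ 0 x ∧ ‖u 0 x‖ ≤ Mp ∧
      ∀ i : Fin 3, |Torus.partialDeriv i (ρ 0) x| ≤ Mp ∧ ‖Torus.partialDeriv i (u 0) x‖ ≤ Mp ∧
        |Torus.partialDeriv i (θ 0) x| ≤ Mp := fun x => by
    obtain ⟨h1, h2, h3, h4, h5⟩ := hg0 x
    refine ⟨h1.trans_le (min_le_left _ _), h2.trans hMMp, hinvMp.trans h3, h4.trans hMMp, fun i => ?_⟩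
    obtain ⟨h6, h7, h8⟩ := h5 i
    exact ⟨h6.trans hMMp, h7.trans hMMp, h8.trans hMMp⟩
  obtain ⟨hu0, hθ0', abar, habar, hαsup, hLip⟩ :=
    H4 σ hσ hσ4 ε n hε hε0 hn T ρ θ u hsol hT δ₀ hδ₀0 hδhalf ubar θbar hnc hguard0 Φ hP h0
  -- the direction of the ray through the data, at amplitude `d₀`
  set α : T3 → ℝ := fun x => Real.log (a₀ x / abar) / d₀ with hα
  set w : T3 → V3 := fun x => d₀⁻¹ • (u₀ x - ubar) with hw
  set ϑ : T3 → ℝ := fun x => (θ₀ x - θbar) / (θbar * d₀) with hϑ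
  have haR : ∀ x, aRay abar α d₀ x = a₀ x := fun x => by
    have e : d₀ * (Real.log (a₀ x / abar) / d₀) = Real.log (a₀ x / abar) := by field_simp
    simp only [aRay, hα, e]
    rw [Real.exp_log (div_pos (ha0 x) habar)]
    field_simp
  have huR : ∀ x, uRay ubar w d₀ x = u₀ x := fun x => by
    simp only [uRay, hw, smul_smul, mul_inv_cancel₀ hd₀0.ne', one_smul, add_sub_cancel]
  have hθR : ∀ x, θRay θbar ϑ d₀ x = θ₀ x := fun x => by
    simp only [θRay, hϑ]
    field_simp
    ring
  have hprof : localGibbsProfile a₀ u₀ θ₀ =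
      localGibbsProfile (aRay abar α d₀) (uRay ubar w d₀) (θRay θbar ϑ d₀) := by
    funext y
    simp only [localGibbsProfile, haR, huR, hθR]
  have hPeq : ∀ N, P N = rayLaw abar θbar ubar α ϑ w (Φ N) d₀ := fun N => by
    simp only [P, rayLaw, ← hprof]
  have hαc : Continuous α :=
    ((ha.div_const abar).log fun x => (div_pos (ha0 x) habar).ne').div_const d₀
  have hwc : Continuous w := by
    rw [hw]; exact (continuous_const : Continuous fun _ : T3 => d₀⁻¹).smul (hu.sub continuous_const)
  have hϑc : Continuous ϑ := (hθ.sub continuous_const).div_const _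
  have hu0x : ∀ x, u₀ x = u 0 x := fun x => by rw [hu0]
  have hθ0x : ∀ x, θ₀ x = θ 0 x := fun x => by rw [hθ0']
  have hMpne : Mp ≠ 0 := hMp0.ne'
  have hd₀ne : d₀ ≠ 0 := hd₀0.ne'
  have hθbar_lo' : (2 * Mp)⁻¹ ≤ θbar := by rw [← hM']; exact hθbar_lo
  have hδϑ : δ₀ ≤ (2 * Mp)⁻¹ * d₀ := by
    rw [hδ₀, inv_mul_eq_div, div_le_div_iff₀ (by positivity) (by positivity)]
    have h2 : 2 * Mp ≤ 4 * K * Mp := mul_le_mul_of_nonneg_right (by linarith) hMp0.le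
    exact mul_le_mul_of_nonneg_left h2 hd₀0.le
  have hkey : K * Mp ≤ L * (θbar * d₀) :=
    calc K * Mp = 2 * K * Mp ^ 2 * (2 * Mp)⁻¹ := by field_simp
      _ ≤ 2 * K * Mp ^ 2 * θbar := mul_le_mul_of_nonneg_left hθbar_lo' (by positivity)
      _ = L * (θbar * d₀) := by rw [hL]; field_simp
  have hsup : ∀ x, |α x| ≤ 1 ∧ |ϑ x| ≤ 1 ∧ ‖w x‖ ≤ 1 := fun x => by
    refine ⟨?_, ?_, ?_⟩
    · simp only [hα]
      rw [abs_div, abs_of_pos hd₀0, div_le_one hd₀0]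
      calc |Real.log (a₀ x / abar)| ≤ K * δ₀ := hαsup x
        _ = d₀ / (4 * Mp) := hKδ
        _ ≤ d₀ := div_le_self hd₀0.le (by linarith)
    · simp only [hϑ]
      rw [abs_div, abs_of_pos (mul_pos hθbar0 hd₀0), div_le_one (mul_pos hθbar0 hd₀0), hθ0x]
      calc |θ 0 x - θbar| ≤ δ₀ := (hnc x).2.2
        _ ≤ (2 * Mp)⁻¹ * d₀ := hδϑ
        _ ≤ θbar * d₀ := mul_le_mul_of_nonneg_right hθbar_lo' hd₀0.le
    · simp only [hw]
      rw [norm_smul, norm_inv, Real.norm_eq_abs, abs_of_pos hd₀0, inv_mul_le_iff₀ hd₀0, mul_one, hu0x]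
      exact ((hnc x).2.1).trans hδd
  have hlip : ∀ x y, |α x - α y| ≤ L * dist x y ∧ |ϑ x - ϑ y| ≤ L * dist x y ∧
      ‖w x - w y‖ ≤ L * dist x y := fun x y => by
    obtain ⟨hla, hlu, hlθ⟩ := hLip x y
    have hdist : 0 ≤ dist x y := dist_nonneg
    have hKMd : K * Mp * dist x y / d₀ ≤ L * dist x y := by
      rw [mul_div_right_comm]; exact mul_le_mul_of_nonneg_right hKML hdist
    refine ⟨?_, ?_, ?_⟩
    · simp only [hα]
      rw [← sub_div, abs_div, abs_of_pos hd₀0, Real.log_div (ha0 x).ne' habar.ne',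
        Real.log_div (ha0 y).ne' habar.ne', sub_sub_sub_cancel_right]
      exact (div_le_div_of_nonneg_right hla hd₀0.le).trans hKMd
    · simp only [hϑ]
      rw [← sub_div, abs_div, abs_of_pos (mul_pos hθbar0 hd₀0), sub_sub_sub_cancel_right,
        div_le_iff₀ (mul_pos hθbar0 hd₀0)]
      calc |θ₀ x - θ₀ y| ≤ K * Mp * dist x y := hlθ
        _ ≤ L * (θbar * d₀) * dist x y := mul_le_mul_of_nonneg_right hkey hdist
        _ = L * dist x y * (θbar * d₀) := by ring
    · simp only [hw]
      rw [← smul_sub, sub_sub_sub_cancel_right, norm_smul, norm_inv, Real.norm_eq_abs, abs_of_pos hd₀0,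
        inv_mul_eq_div]
      exact (div_le_div_of_nonneg_right hlu hd₀0.le).trans hKMd
  -- a bound for the test function
  obtain ⟨B, hB⟩ : ∃ B : ℝ, ∀ x, |χ x| ≤ B := by
    obtain ⟨B, hB⟩ := isCompact_univ.exists_bound_of_continuousOn hχ.continuousOn
    exact ⟨B, fun x => by simpa [Real.norm_eq_abs] using hB x (mem_univ x)⟩
  have hB0 : 0 ≤ B := (abs_nonneg _).trans (hB x₀)
  have hCB : 0 ≤ C * B := mul_nonneg hC hB0
  -- STUB 1: the holomorphic interpolants on the disc of radius `R₁ = 3 d₀`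
  set R₁ : ℝ := 3 * d₀ with hR₁
  have hR₁0 : 0 < R₁ := by positivity
  have hR₁c : R₁ * (1 + L * t) ≤ r₀ := by
    calc R₁ * (1 + L * t) ≤ 3 * d₀ * (1 + 1) := by rw [hR₁]; gcongr
      _ ≤ r₀ := by linarith
  have hG1 := H1 σ hσ hσ1 abar θbar ubar habar hθbar_lo hθbar_hi hubar α ϑ w hαc hϑc hwc hsup hlip ε n hε
    hε0 hn Φ t ⟨ht0, ht1⟩ χ hχ B hB c₀ c₄ c hc₀ hc₄ hc R₁ hR₁0 hR₁c
  obtain ⟨N₀, hN₀⟩ := eventually_atTop.1 hG1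
  choose! gN hgN using hN₀
  let G : ℕ → ℂ → ℂ := fun N => if N₀ ≤ N then gN N else fun _ => 0
  have hGle : ∀ N, N₀ ≤ N → G N = gN N := fun N h => if_pos h
  have hGd : ∀ N, DifferentiableOn ℂ (G N) (ball 0 R₁) ∧ ∀ ζ ∈ ball (0 : ℂ) R₁, ‖G N ζ‖ ≤ C * B := by
    intro N
    by_cases h : N₀ ≤ N
    · rw [hGle N h]; exact ⟨(hgN N h).1, (hgN N h).2.1⟩
    · have e : G N = fun _ => 0 := if_neg h
      rw [e]; exact ⟨differentiableOn_const 0, fun ζ _ => by simpa using hCB⟩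
  have hGev : ∀ᶠ N : ℕ in atTop, ∀ d : ℝ, |d| < R₁ →
      Integrable (fun z => consField c₀ c c₄ ((Φ N).flow t z) χ) (rayLaw abar θbar ubar α ϑ w (Φ N) d) ∧
      G N (d : ℂ) = ((∫ z, consField c₀ c c₄ ((Φ N).flow t z) χ ∂(rayLaw abar θbar ubar α ϑ w (Φ N) d) : ℝ) : ℂ) :=
    eventually_atTop.2 ⟨N₀, fun N h => by rw [hGle N h]; exact (hgN N h).2.2⟩
  -- STUB 3: the tied analytic Euler ray through the given solution
  have hPray : ∀ N, IsProbabilityMeasure (rayLaw abar θbar ubar α ϑ w (Φ N) d₀) := fun N => hPeq N ▸ hP N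
  have h0ray : LLNAt (fun N => rayLaw abar θbar ubar α ϑ w (Φ N) d₀) Φ ρ u θ 0 := by
    intro χ' hχ' δ hδ
    have := h0 χ' hχ' δ hδ
    simp only [hPeq] at this
    exact this
  have hgE : ∀ s ∈ Set.Icc 0 t, ∀ x, ρ s x * σ ^ 3 < ηE ∧ θ s x ≤ M' ∧ M'⁻¹ ≤ θ s x ∧ ‖u s x‖ ≤ M' ∧
      ∀ i : Fin 3, |Torus.partialDeriv i (ρ s) x| ≤ M' ∧ ‖Torus.partialDeriv i (u s) x‖ ≤ M' ∧
        |Torus.partialDeriv i (θ s) x| ≤ M' := fun s hs x => by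
    obtain ⟨h1, h2, h3, h4, h5⟩ := hg s hs x
    refine ⟨h1.trans_le (min_le_right _ _), h2.trans hMM', hinvM'.trans h3, h4.trans hMM', fun i => ?_⟩
    obtain ⟨h6, h7, h8⟩ := h5 i
    exact ⟨h6.trans hMM', h7.trans hMM', h8.trans hMM'⟩
  obtain ⟨T', htT', ρE, θE, uE, hsolE, hmem, htieE, hFE⟩ :=
    H3 σ hσ hσ3 abar θbar ubar habar hθbar_lo hθbar_hi hubar α ϑ w hαc hϑc hwc hsup d₀ hd₀0 hd₀E ε n hε hε0
      hn T ρ θ u hsol Φ hPray h0ray t ⟨ht0, lt_min htT htE⟩ hgE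
  obtain ⟨RE, hRE, F, hFd, hFeq⟩ := hFE χ hχ c₀ c₄ c
  -- STUB 2: the jets of the interpolants converge to the jets of the Euler ray map
  have hT'0 : 0 < T' := ht0.trans_lt htT'
  have hGagree : ∀ᶠ N : ℕ in atTop, DifferentiableOn ℂ (G N) (ball 0 R₁) ∧ ∀ d : ℝ, |d| < R₁ →
      G N (d : ℂ) = ((∫ z, consField c₀ c c₄ ((Φ N).flow t z) χ ∂(rayLaw abar θbar ubar α ϑ w (Φ N) d) : ℝ) : ℂ) :=
    hGev.mono fun N hN => ⟨(hGd N).1, fun d hd => (hN d hd).2⟩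
  have hFeq' : ∀ d : ℝ, 0 ≤ d → d ≤ d₀ → d < RE →
      F (d : ℂ) = ((eulerVal c₀ c c₄ χ (ρE d t) (uE d t) (θE d t) : ℝ) : ℂ) :=
    fun d h0 h1 _ => hFeq d ⟨h0, h1⟩
  have hjet := H2 σ hσ hσ2 abar θbar ubar habar hθbar_lo hθbar_hi hubar α ϑ w hαc hϑc hwc hsup ε n hε hε0 hn Φ
    d₀ T' hd₀0 hT'0 ρE θE uE hsolE htieE t ⟨ht0, htT'⟩ χ hχ c₀ c₄ c G R₁ hR₁0 hGagree F RE (hd₀0.trans hRE)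
    hFd hFeq'
  -- transfer (tree: uniformly bounded analytic family + convergence of the Taylor coefficients)
  set R₂ : ℝ := 2 * d₀ with hR₂
  have hR₂0 : 0 < R₂ := by positivity
  have hcl : closedBall (0 : ℂ) R₂ ⊆ ball 0 R₁ := closedBall_subset_ball (by linarith)
  have hdc : ∀ N, DiffContOnCl ℂ (G N) (ball 0 R₂) := fun N => (hGd N).1.diffContOnCl_ball hcl
  have hsph : ∀ N, ∀ z ∈ sphere (0 : ℂ) R₂, ‖G N z‖ ≤ C * B := fun N z hz =>
    (hGd N).2 z (hcl (sphere_subset_closedBall hz))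
  have hcoef : ∀ m : ℕ, Tendsto (fun N => (m ! : ℂ)⁻¹ • iteratedDeriv m (G N) 0) atTop
      (𝓝 ((m ! : ℂ)⁻¹ • iteratedDeriv m F 0)) := fun m => (hjet m).const_smul _
  have hd₀n : ‖((d₀ : ℝ) : ℂ)‖ < R₂ := by
    rw [Complex.norm_real, Real.norm_eq_abs, abs_of_pos hd₀0]; linarith
  have hlim := Literature.Analysis.Complex.tendsto_of_forall_tendsto_taylorCoeff hR₂0 hdc hsph hcoef hd₀n
  have hsum : ∑' m : ℕ, ((d₀ : ℝ) : ℂ) ^ m • ((m ! : ℂ)⁻¹ • iteratedDeriv m F 0) = F d₀ := by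
    have hz : ((d₀ : ℝ) : ℂ) ∈ ball (0 : ℂ) RE := by
      rw [mem_ball_zero_iff, Complex.norm_real, Real.norm_eq_abs, abs_of_pos hd₀0]; exact hRE
    rw [← Complex.taylorSeries_eq_on_ball hFd hz]
    refine tsum_congr fun m => ?_
    simp only [sub_zero, smul_eq_mul]
    ring
  rw [hsum] at hlim
  -- conclusion at the amplitude `d₀`, i.e. for the crux's own laws `P N`
  have hGd₀ : ∀ᶠ N : ℕ in atTop,
      Integrable (fun z => consField c₀ c c₄ ((Φ N).flow t z) χ) (rayLaw abar θbar ubar α ϑ w (Φ N) d₀) ∧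
      G N ((d₀ : ℝ) : ℂ) =
        ((∫ z, consField c₀ c c₄ ((Φ N).flow t z) χ ∂(rayLaw abar θbar ubar α ϑ w (Φ N) d₀) : ℝ) : ℂ) :=
    hGev.mono fun N hN => hN d₀ (by rw [abs_of_pos hd₀0]; linarith)
  have hF₀ : F d₀ = ((eulerVal c₀ c c₄ χ (ρ t) (u t) (θ t) : ℝ) : ℂ) := by
    rw [hFeq d₀ ⟨hd₀0.le, le_rfl⟩]
    obtain ⟨e1, e2, e3⟩ := hmem t ⟨ht0, htT'⟩
    rw [e1, e2, e3]
  rw [hF₀] at hlim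
  refine ⟨?_, ?_⟩
  · filter_upwards [hGd₀] with N hN
    rw [hPeq N]
    exact hN.1
  · have hlim' : Tendsto (fun N : ℕ => ((∫ z, consField c₀ c c₄ ((Φ N).flow t z) χ ∂(P N) : ℝ) : ℂ)) atTop
        (𝓝 ((eulerVal c₀ c c₄ χ (ρ t) (u t) (θ t) : ℝ) : ℂ)) := by
      refine hlim.congr' ?_
      filter_upwards [hGd₀] with N hN
      rw [hN.2, hPeq N]
    have := (Complex.continuous_re.tendsto _).comp hlim'
    exact this

/-- **The skeleton theorem**: the crux from the five registered stubs (and the landed `stub_entropyToLLN`). -/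
theorem NearConstantShortTimeHL_of (h₁ : stub_tiltRadius) (h₂ : stub_jetIdentification)
    (h₃ : stub_tiedAnalyticRay) (h₄ : stub_tieInversion) (h₅ : stub_meansPin) :
    Summit.AtomisticToContinuum.HydrodynamicLimit.Theses.RelayRaceLocality.NearConstantShortTimeHL :=
  stub_entropyToLLN ((h₅ : type_of% Holds.stub_meansPin) (meansConvergeNC_of h₁ h₂ h₃ h₄))

example : Summit.AtomisticToContinuum.HydrodynamicLimit.Theses.RelayRaceLocality.NearConstantShortTimeHL :=
  NearConstantShortTimeHL_of Holds.stub_tiltRadius Holds.stub_jetIdentification Holds.stub_tiedAnalyticRay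
    Holds.stub_tieInversion Holds.stub_meansPin

end Summit.AtomisticToContinuum.HydrodynamicLimit.Cruxes.NearConstantShortTimeHL.TiltRadius

end
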